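import Summits.AtomisticToContinuum.Crystallization.Theorems.ChartedZeroExcessLayeredLatticeLiouvilleZZE

/-!
# Part ZZJ «CompetitorCones» (lens-2 g80; (B′.3c) of the REACH DESIGN: METRIC LOCALISATION of the two certified competitor classes,
critic row 1467 (B) ruling (c2))

The exact quadtree certificate (riders ZZH/ZZI v2, `pin_certificate` + `cell_sound`) leaves, besides the pinned site itself, only two classes of
index competitors `z` for the partner of a zone atom `x` (leaf census over all 16 stacking contexts, 6 912 boxes):
* (I) DOUBLES `z = 2m`, `m` a first-shell member (`|ι z|² = 72`), certified within `45°` of the layered direction `w*` (`capZB 1 2`);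
* (II) APEXES `ι z = ±(4,4,4)` (`|ι z|² = 48`), certified within `arccos √(5/9) ≈ 41.81°` (`capZB 5 9`).
This file proves, as ABSTRACT inner-product-space lemmas in the style of ZZE (no configuration, no pattern bookkeeping), that the physical
position `Ψ z` of such a competitor lies in the `60°`-cone of `w` at `Ψ x` — so that ZZE's `dist_add_half_le_of_cone` / `mem_moatIn_of_cone`
make it a STRICTLY DEEPER zone atom (radial gain `½‖Ψz − Ψx‖ ≥ (7/8)·a` resp. `≥ (3/4)·a`), which the downward-`Φ` induction of (B′.5) has
already matched, excluding it by injectivity.  NO frame coherence between atoms and NO bond coherence (GC) is used: every estimate lives in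
ONE atom's rigid two-shell pattern (tolerance `a/16`, critic row 1457 (E) «honest θ = 1/16»), and different atoms' scales `a, a′` are never compared.

* §1 (I) `double_cone`: the x-pattern places the member `n = Ψm` within `a/16` of `p + U` with `⟪U, w⟫ ≥ √(1/2)‖U‖‖w‖`; the m-pattern places
  `p = Ψx` and `z′ = Ψz` within `a′/16` of the ANTIPODAL points `n ± U′` (`x` and `2m − x` are antipodal in `link m`).  Chain
  `U →(0.0633) n − p →(1/15 relative) z′ − p`: `⟪z′ − p, w⟫ ≥ 0.608·‖z′ − p‖‖w‖ ≥ ½·…`; lengths `(7/4)a′ ≤ ‖z′ − p‖ ≤ (17/8)a′`.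
* §2 (II) `apex_cone`: cap atom `c` (adjacent to `x` and `z`) with its lower triangle `{x, h₁, h₂}`; the vector
  `V := 3(Ψc − Ψx) − (Ψh₁ − Ψx) − (Ψh₂ − Ψx)` is read in BOTH patterns: x-pattern `‖V − N‖ ≤ 5a/16` with `‖N‖ = √6·a`,
  `⟪N, w⟫ ≥ √(5/9)‖N‖‖w‖` (certified apex cap: `N ∥ F_x(4,4,4)`); c-pattern `‖V − M‖ ≤ 3a′/16`, `M := −(Q_x + Q₁ + Q₂)`, `‖M‖ = √6·a′`, and
  `z′ − p` within `a′/8` of `Q_z − Q_x = (2/3)M`.  Chain `N → V → M → z′ − p` with cosines `0.7453 → 0.6530 → 0.5863 → 0.5214 ≥ ½`;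
  lengths `(3/2)a′ ≤ ‖z′ − p‖ ≤ (44/25)a′`.
* §3 record numerology: the radial gains and reaches against ZZE's record cone step (`L = 43/20`).

0 sorry; standard axioms.  Consumers: rider «pin step» ((c1) index packaging of ZZH/ZZI + these cones + ZZE), rider ZZK «dictionary» (supplies
`U, U′, P, Q` from `IsTwoShellGoodSet` and the certificate's `capZB` facts via ZZH `inner_ge_of_capZB`).
-/

noncomputable section
open scoped BigOperators Classical InnerProductSpace RealInnerProductSpace
open MeasureTheory Set Metric Filter Topology

namespace Summit.AtomisticToContinuum.Crystallization.Theorems.ChartedZeroExcessLayeredLatticeLiouville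

section Metric

variable {V : Type*} [NormedAddCommGroup V] [InnerProductSpace ℝ V]

/-! ### §0  Two small helpers -/

/-- `7071/10000 ≤ √(1/2)` (the certified double cap `cos² ≥ 1/2`). [this file, g80] -/
theorem sqrt_half_ge : (7071 : ℝ) / 10000 ≤ Real.sqrt (1 / 2) := by
  rw [show (7071 : ℝ) / 10000 = Real.sqrt ((7071 / 10000) ^ 2) by rw [Real.sqrt_sq (by norm_num)]]
  exact Real.sqrt_le_sqrt (by norm_num)

/-- `7453/10000 ≤ √(5/9)` (the certified apex cap `cos² ≥ 5/9`). [this file, g80] -/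
theorem sqrt_five_ninths_ge : (7453 : ℝ) / 10000 ≤ Real.sqrt (5 / 9) := by
  rw [show (7453 : ℝ) / 10000 = Real.sqrt ((7453 / 10000) ^ 2) by rw [Real.sqrt_sq (by norm_num)]]
  exact Real.sqrt_le_sqrt (by norm_num)

/-- `2449/1000 ≤ √6`. [this file, g80] -/
theorem sqrt_six_ge : (2449 : ℝ) / 1000 ≤ Real.sqrt 6 := by
  rw [show (2449 : ℝ) / 1000 = Real.sqrt ((2449 / 1000) ^ 2) by rw [Real.sqrt_sq (by norm_num)]]
  exact Real.sqrt_le_sqrt (by norm_num)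

/-- `√6 ≤ 2450/1000`. [this file, g80] -/
theorem sqrt_six_le : Real.sqrt 6 ≤ (2450 : ℝ) / 1000 := by
  rw [show (2450 : ℝ) / 1000 = Real.sqrt ((2450 / 1000) ^ 2) by rw [Real.sqrt_sq (by norm_num)]]
  exact Real.sqrt_le_sqrt (by norm_num)

/-- a cosine lower bound scales to positive multiples: `⟪U, w⟫ ≥ c‖U‖‖w‖ ⇒ ⟪t•U, w⟫ ≥ c‖t•U‖‖w‖` for `0 ≤ t`. [this file, g80] -/
theorem inner_smul_ge_of_inner_ge {U w : V} {c t : ℝ} (ht : 0 ≤ t) (h : c * (‖U‖ * ‖w‖) ≤ ⟪U, w⟫_ℝ) :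
    c * (‖t • U‖ * ‖w‖) ≤ ⟪t • U, w⟫_ℝ := by
  rw [norm_smul, Real.norm_of_nonneg ht, inner_smul_left, RCLike.conj_to_real]
  nlinarith [mul_le_mul_of_nonneg_left h ht]

/-! ### §1  Class (I): doubles `z = 2m` -/

/-- ★★ **DOUBLE CONE.**  x-pattern: `‖U‖ = a > 0`, the member `n` within `a/16` of `p + U`, `⟪U, w⟫ ≥ √(1/2)‖U‖‖w‖` (certified `45°` cap);
m-pattern: `‖U′‖ = a′ > 0`, `p` within `a′/16` of `n + U′` and `z′` within `a′/16` of `n − U′` (antipodal sites of `link m`).  Then `z′ − p` lies in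
the `60°`-cone of `w`: `½‖z′ − p‖‖w‖ ≤ ⟪z′ − p, w⟫`.  Chain: `⟪n − p, w⟫ ≥ κ₁‖n − p‖‖w‖`, `κ₁ = 0.998·0.7071 − 0.0633·0.7072 = 0.66092`
(ZZE `inner_ge_of_near_of_toward`); `‖(z′ − p) − 2(n − p)‖ ≤ a′/8 ≤ (1/15)‖2(n − p)‖` (`‖n − p‖ ≥ 15a′/16`); second application with
`(c₁, s₁, c₂, s₂) = (0.9977, 0.068, κ₁, 0.7505)`: `0.9977·κ₁ − 0.068·0.7505 = 0.6083 ≥ ½`. [this file, g80] -/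
theorem double_cone {p n z' U U' w : V} {a a' : ℝ} (ha : 0 < a) (hU : ‖U‖ = a) (hn : dist n (p + U) ≤ 1 / 16 * a)
    (hw : Real.sqrt (1 / 2) * (‖U‖ * ‖w‖) ≤ ⟪U, w⟫_ℝ) (ha' : 0 < a') (hU' : ‖U'‖ = a')
    (hp : dist p (n + U') ≤ 1 / 16 * a') (hz : dist z' (n - U') ≤ 1 / 16 * a') :
    1 / 2 * (‖z' - p‖ * ‖w‖) ≤ ⟪z' - p, w⟫_ℝ := by
  have hU0 : U ≠ 0 := by rw [← norm_pos_iff, hU]; exact ha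
  have hb : ‖(n - p) - U‖ ≤ 1 / 16 * a := by rw [sub_sub, ← dist_eq_norm]; exact hn
  have hw' : 7071 / 10000 * (‖U‖ * ‖w‖) ≤ ⟪U, w⟫_ℝ :=
    (mul_le_mul_of_nonneg_right sqrt_half_ge (by positivity)).trans hw
  -- step 1: the member direction `n − p`
  have h1 := inner_ge_of_near_of_toward (c₁ := 998 / 1000) (s₁ := 633 / 10000) (c₂ := 7071 / 10000) (s₂ := 7072 / 10000) hU0 hb
    (by norm_num) (by norm_num) (by norm_num) (by norm_num) (by rw [hU]; nlinarith [sq_nonneg a]) (by norm_num) (by norm_num) hw'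
  -- the member is at distance ≥ 15a′/16 (m-pattern)
  have hbn : 15 / 16 * a' ≤ ‖n - p‖ := by
    have h2 : ‖(p - n) - U'‖ ≤ 1 / 16 * a' := by rw [sub_sub, ← dist_eq_norm]; exact hp
    have h3 : ‖U'‖ ≤ ‖p - n‖ + ‖(p - n) - U'‖ := by
      have := norm_sub_le (p - n) ((p - n) - U'); rwa [sub_sub_cancel] at this
    rw [norm_sub_rev n p]; linarith [hU', h2, h3]
  have hb0 : (2 : ℝ) • (n - p) ≠ 0 := by
    rw [← norm_pos_iff, norm_smul, Real.norm_two]; nlinarith [hbn, ha']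
  -- step 2: `z′ − p` is within `a′/8` of `2(n − p)`
  have hD : ‖(z' - p) - (2 : ℝ) • (n - p)‖ ≤ 1 / 8 * a' := by
    have e : (z' - p) - (2 : ℝ) • (n - p) = (z' - (n - U')) + (p - (n + U')) := by
      rw [two_smul]; abel
    rw [e]
    calc ‖(z' - (n - U')) + (p - (n + U'))‖ ≤ ‖z' - (n - U')‖ + ‖p - (n + U')‖ := norm_add_le _ _
      _ ≤ 1 / 16 * a' + 1 / 16 * a' := add_le_add (by rw [← dist_eq_norm]; exact hz) (by rw [← dist_eq_norm]; exact hp)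
      _ = 1 / 8 * a' := by ring
  have h2n : ‖(2 : ℝ) • (n - p)‖ = 2 * ‖n - p‖ := by rw [norm_smul, Real.norm_two]
  have hw2 : (998 / 1000 * (7071 / 10000) - 633 / 10000 * (7072 / 10000)) * (‖(2 : ℝ) • (n - p)‖ * ‖w‖) ≤ ⟪(2 : ℝ) • (n - p), w⟫_ℝ :=
    inner_smul_ge_of_inner_ge (by norm_num) h1
  have h2 := inner_ge_of_near_of_toward (c₁ := 9977 / 10000) (s₁ := 68 / 1000)
    (c₂ := 998 / 1000 * (7071 / 10000) - 633 / 10000 * (7072 / 10000)) (s₂ := 7505 / 10000) hb0 hD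
    (by norm_num) (by norm_num) (by norm_num) (by norm_num) (by rw [h2n]; nlinarith [hbn, ha'.le]) (by norm_num) (by norm_num) hw2
  have h0 : 0 ≤ ‖z' - p‖ * ‖w‖ := by positivity
  linarith [mul_le_mul_of_nonneg_right (show (1 : ℝ) / 2 ≤ 9977 / 10000 * (998 / 1000 * (7071 / 10000) - 633 / 10000 * (7072 / 10000))
    - 68 / 1000 * (7505 / 10000) by norm_num) h0]

/-- ★ **DOUBLE LENGTHS** (m-pattern only): `(7/4)a′ ≤ ‖z′ − p‖ ≤ (17/8)a′` — the reach `17/8 ≤ 43/20` of ZZE's record cone step. [this file, g80] -/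
theorem double_norm_bounds {p n z' U' : V} {a' : ℝ} (hU' : ‖U'‖ = a')
    (hp : dist p (n + U') ≤ 1 / 16 * a') (hz : dist z' (n - U') ≤ 1 / 16 * a') :
    7 / 4 * a' ≤ ‖z' - p‖ ∧ ‖z' - p‖ ≤ 17 / 8 * a' := by
  have e : z' - p = ((z' - (n - U')) - (p - (n + U'))) - (2 : ℝ) • U' := by rw [two_smul]; abel
  have hE : ‖(z' - (n - U')) - (p - (n + U'))‖ ≤ 1 / 8 * a' :=
    calc ‖(z' - (n - U')) - (p - (n + U'))‖ ≤ ‖z' - (n - U')‖ + ‖p - (n + U')‖ := norm_sub_le _ _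
      _ ≤ 1 / 16 * a' + 1 / 16 * a' := add_le_add (by rw [← dist_eq_norm]; exact hz) (by rw [← dist_eq_norm]; exact hp)
      _ = 1 / 8 * a' := by ring
  have h2U : ‖(2 : ℝ) • U'‖ = 2 * a' := by rw [norm_smul, Real.norm_two, hU']
  constructor
  · rw [e]
    have := norm_sub_norm_le ((2 : ℝ) • U') ((z' - (n - U')) - (p - (n + U')))
    rw [norm_sub_rev ((2 : ℝ) • U')] at this
    linarith [norm_nonneg ((z' - (n - U')) - (p - (n + U')))]
  · rw [e]
    linarith [norm_sub_le ((z' - (n - U')) - (p - (n + U'))) ((2 : ℝ) • U')]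

/-! ### §2  Class (II): apexes `ι z = ±(4,4,4)` -/

/-- ★ **APEX CHAIN** (pure vectors): `‖N‖ = √6·a`, `⟪N, w⟫ ≥ √(5/9)‖N‖‖w‖`, `‖W − N‖ ≤ 5a/16`; `‖M‖ = √6·a′`, `‖M − W‖ ≤ 3a′/16`;
`‖D − (2/3)M‖ ≤ a′/8` ⇒ `½‖D‖‖w‖ ≤ ⟪D, w⟫`.  Three applications of ZZE `inner_ge_of_near_of_toward`:
`κ₂ = 0.9917·0.7453 − 0.129·0.6668 = 0.6531` (`W` vs `w`), `κ₃ = 0.9964·κ₂ − 0.085·0.7573 = 0.5864` (`M` vs `w`, using `‖W‖ ≥ (√6 − 3/16)a′`),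
`0.997·κ₃ − 0.078·0.8101 = 0.5214 ≥ ½` (`D` vs `w`). [this file, g80] -/
theorem apex_chain {N W M D w : V} {a a' : ℝ} (ha : 0 < a) (ha' : 0 < a') (hN : ‖N‖ = Real.sqrt 6 * a)
    (hw : Real.sqrt (5 / 9) * (‖N‖ * ‖w‖) ≤ ⟪N, w⟫_ℝ) (hWN : ‖W - N‖ ≤ 5 / 16 * a) (hM : ‖M‖ = Real.sqrt 6 * a')
    (hWM : ‖M - W‖ ≤ 3 / 16 * a') (hD : ‖D - ((2 : ℝ) / 3) • M‖ ≤ 1 / 8 * a') :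
    1 / 2 * (‖D‖ * ‖w‖) ≤ ⟪D, w⟫_ℝ := by
  have h6 := sqrt_six_ge
  have hsq6 : Real.sqrt 6 ^ 2 = 6 := Real.sq_sqrt (by norm_num)
  have hNn : ‖N‖ ^ 2 = 6 * a ^ 2 := by rw [hN, mul_pow, hsq6]
  have hN0 : N ≠ 0 := by rw [← norm_pos_iff, hN]; positivity
  -- step 1: `W` vs `w`
  have hw' : 7453 / 10000 * (‖N‖ * ‖w‖) ≤ ⟪N, w⟫_ℝ :=
    (mul_le_mul_of_nonneg_right sqrt_five_ninths_ge (by positivity)).trans hw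
  have k2 := inner_ge_of_near_of_toward (c₁ := 9917 / 10000) (s₁ := 129 / 1000) (c₂ := 7453 / 10000) (s₂ := 6668 / 10000) hN0 hWN
    (by norm_num) (by norm_num) (by norm_num) (by norm_num) (by rw [hNn]; nlinarith [sq_nonneg a]) (by norm_num) (by norm_num) hw'
  -- step 2: `M` vs `w` (`‖W‖ ≥ (√6 − 3/16)a′`)
  have hWge : (2449 / 1000 - 3 / 16) * a' ≤ ‖W‖ := by
    have := norm_sub_norm_le M (M - W)
    rw [sub_sub_cancel] at this
    linarith [mul_le_mul_of_nonneg_right h6 ha'.le]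
  have hW0 : W ≠ 0 := by rw [← norm_pos_iff]; linarith [mul_pos (show (0 : ℝ) < 2449 / 1000 - 3 / 16 by norm_num) ha']
  have hWsq : ((2449 / 1000 - 3 / 16) * a') ^ 2 ≤ ‖W‖ ^ 2 := pow_le_pow_left₀ (by positivity) hWge 2
  have k3 := inner_ge_of_near_of_toward (c₁ := 9964 / 10000) (s₁ := 85 / 1000)
    (c₂ := 9917 / 10000 * (7453 / 10000) - 129 / 1000 * (6668 / 10000)) (s₂ := 7573 / 10000) hW0 hWM
    (by norm_num) (by norm_num) (by norm_num) (by norm_num) (by nlinarith [hWsq, sq_nonneg a']) (by norm_num) (by norm_num) k2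
  -- step 3: `D` vs `w`
  have hM0 : ((2 : ℝ) / 3) • M ≠ 0 := by
    rw [← norm_pos_iff, norm_smul, Real.norm_of_nonneg (by norm_num : (0 : ℝ) ≤ 2 / 3), hM]; positivity
  have hMn' : ‖((2 : ℝ) / 3) • M‖ ^ 2 = 8 / 3 * a' ^ 2 := by
    rw [norm_smul, Real.norm_of_nonneg (by norm_num : (0 : ℝ) ≤ 2 / 3), hM, mul_pow, mul_pow, hsq6]; ring
  have hw3 : (9964 / 10000 * (9917 / 10000 * (7453 / 10000) - 129 / 1000 * (6668 / 10000)) - 85 / 1000 * (7573 / 10000)) *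
      (‖((2 : ℝ) / 3) • M‖ * ‖w‖) ≤ ⟪((2 : ℝ) / 3) • M, w⟫_ℝ := inner_smul_ge_of_inner_ge (by norm_num) k3
  have k4 := inner_ge_of_near_of_toward (c₁ := 9970 / 10000) (s₁ := 78 / 1000)
    (c₂ := 9964 / 10000 * (9917 / 10000 * (7453 / 10000) - 129 / 1000 * (6668 / 10000)) - 85 / 1000 * (7573 / 10000))
    (s₂ := 8101 / 10000) hM0 hD (by norm_num) (by norm_num) (by norm_num) (by norm_num)
    (by rw [hMn']; nlinarith [sq_nonneg a']) (by norm_num) (by norm_num) hw3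
  have h0 : 0 ≤ ‖D‖ * ‖w‖ := by positivity
  linarith [mul_le_mul_of_nonneg_right (show (1 : ℝ) / 2 ≤ 9970 / 10000 *
    (9964 / 10000 * (9917 / 10000 * (7453 / 10000) - 129 / 1000 * (6668 / 10000)) - 85 / 1000 * (7573 / 10000)) - 78 / 1000 * (8101 / 10000)
    by norm_num) h0]

/-- the x-pattern reading of `V := 3(q − p) − (h₁ − p) − (h₂ − p)`: within `5a/16` of `N := 3P_c − P₁ − P₂`. [this file, g80] -/
theorem apex_near_x {p q h₁ h₂ Pc P₁ P₂ : V} {a : ℝ}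
    (hq : dist q (p + Pc) ≤ 1 / 16 * a) (hh₁ : dist h₁ (p + P₁) ≤ 1 / 16 * a) (hh₂ : dist h₂ (p + P₂) ≤ 1 / 16 * a) :
    ‖((3 : ℝ) • (q - p) - (h₁ - p) - (h₂ - p)) - ((3 : ℝ) • Pc - P₁ - P₂)‖ ≤ 5 / 16 * a := by
  have tq : ‖q - p - Pc‖ ≤ 1 / 16 * a := by rw [sub_sub, ← dist_eq_norm]; exact hq
  have t1 : ‖h₁ - p - P₁‖ ≤ 1 / 16 * a := by rw [sub_sub, ← dist_eq_norm]; exact hh₁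
  have t2 : ‖h₂ - p - P₂‖ ≤ 1 / 16 * a := by rw [sub_sub, ← dist_eq_norm]; exact hh₂
  have e : ((3 : ℝ) • (q - p) - (h₁ - p) - (h₂ - p)) - ((3 : ℝ) • Pc - P₁ - P₂) =
      (3 : ℝ) • (q - p - Pc) - (h₁ - p - P₁) - (h₂ - p - P₂) := by
    simp only [smul_sub]; abel
  rw [e]
  calc ‖(3 : ℝ) • (q - p - Pc) - (h₁ - p - P₁) - (h₂ - p - P₂)‖
      ≤ ‖(3 : ℝ) • (q - p - Pc)‖ + ‖h₁ - p - P₁‖ + ‖h₂ - p - P₂‖ := norm_sub_le_of_le (norm_sub_le _ _) le_rfl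
    _ ≤ 3 * (1 / 16 * a) + 1 / 16 * a + 1 / 16 * a := by
        rw [norm_smul, Real.norm_of_nonneg (by norm_num : (0 : ℝ) ≤ 3)]
        exact add_le_add (add_le_add (mul_le_mul_of_nonneg_left tq (by norm_num)) t1) t2
    _ = 5 / 16 * a := by ring

/-- the c-pattern reading of the same `V`: within `3a′/16` of `M := −(Q_x + Q₁ + Q₂)`. [this file, g80] -/
theorem apex_near_c {p q h₁ h₂ Qx Q₁ Q₂ : V} {a' : ℝ}
    (hx : dist p (q + Qx) ≤ 1 / 16 * a') (hh₁' : dist h₁ (q + Q₁) ≤ 1 / 16 * a') (hh₂' : dist h₂ (q + Q₂) ≤ 1 / 16 * a') :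
    ‖-(Qx + Q₁ + Q₂) - ((3 : ℝ) • (q - p) - (h₁ - p) - (h₂ - p))‖ ≤ 3 / 16 * a' := by
  have tx : ‖p - q - Qx‖ ≤ 1 / 16 * a' := by rw [sub_sub, ← dist_eq_norm]; exact hx
  have t1' : ‖h₁ - q - Q₁‖ ≤ 1 / 16 * a' := by rw [sub_sub, ← dist_eq_norm]; exact hh₁'
  have t2' : ‖h₂ - q - Q₂‖ ≤ 1 / 16 * a' := by rw [sub_sub, ← dist_eq_norm]; exact hh₂'
  have e : -(Qx + Q₁ + Q₂) - ((3 : ℝ) • (q - p) - (h₁ - p) - (h₂ - p)) = (p - q - Qx) + (h₁ - q - Q₁) + (h₂ - q - Q₂) := by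
    rw [smul_sub, show (3 : ℝ) • q = q + q + q by rw [show (3 : ℝ) = 1 + 1 + 1 by norm_num, add_smul, add_smul, one_smul],
      show (3 : ℝ) • p = p + p + p by rw [show (3 : ℝ) = 1 + 1 + 1 by norm_num, add_smul, add_smul, one_smul]]
    abel
  rw [e]
  calc ‖(p - q - Qx) + (h₁ - q - Q₁) + (h₂ - q - Q₂)‖ ≤ ‖p - q - Qx‖ + ‖h₁ - q - Q₁‖ + ‖h₂ - q - Q₂‖ := norm_add₃_le
    _ ≤ 1 / 16 * a' + 1 / 16 * a' + 1 / 16 * a' := add_le_add (add_le_add tx t1') t2'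
    _ = 3 / 16 * a' := by ring

/-- ★★ **APEX CONE.**  x-pattern (`a > 0`): cap atom `q` within `a/16` of `p + P_c`, lower-triangle atoms `h₁, h₂` within `a/16` of `p + P₁, p + P₂`,
`N := 3P_c − P₁ − P₂` with `‖N‖ = √6·a` and the certified apex cap `⟪N, w⟫ ≥ √(5/9)‖N‖‖w‖`; c-pattern (`a′ > 0`): `p, h₁, h₂, z′` within `a′/16` of
`q + Q_x, q + Q₁, q + Q₂, q + Q_z`, with `‖Q_x + Q₁ + Q₂‖ = √6·a′` and `Q_z − Q_x = −(2/3)(Q_x + Q₁ + Q₂)`.  Then `½‖z′ − p‖‖w‖ ≤ ⟪z′ − p, w⟫`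
(`apex_chain` on `V := 3(q − p) − (h₁ − p) − (h₂ − p)`, `apex_near_x`, `apex_near_c`, and `‖(z′ − p) − (Q_z − Q_x)‖ ≤ a′/8`). [this file, g80] -/
theorem apex_cone {p q h₁ h₂ z' Pc P₁ P₂ Qx Q₁ Q₂ Qz w : V} {a a' : ℝ} (ha : 0 < a)
    (hq : dist q (p + Pc) ≤ 1 / 16 * a) (hh₁ : dist h₁ (p + P₁) ≤ 1 / 16 * a) (hh₂ : dist h₂ (p + P₂) ≤ 1 / 16 * a)
    (hN : ‖(3 : ℝ) • Pc - P₁ - P₂‖ = Real.sqrt 6 * a)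
    (hw : Real.sqrt (5 / 9) * (‖(3 : ℝ) • Pc - P₁ - P₂‖ * ‖w‖) ≤ ⟪(3 : ℝ) • Pc - P₁ - P₂, w⟫_ℝ) (ha' : 0 < a')
    (hx : dist p (q + Qx) ≤ 1 / 16 * a') (hh₁' : dist h₁ (q + Q₁) ≤ 1 / 16 * a') (hh₂' : dist h₂ (q + Q₂) ≤ 1 / 16 * a')
    (hz : dist z' (q + Qz) ≤ 1 / 16 * a') (hM : ‖Qx + Q₁ + Q₂‖ = Real.sqrt 6 * a')
    (hQz : Qz - Qx = -((2 : ℝ) / 3) • (Qx + Q₁ + Q₂)) :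
    1 / 2 * (‖z' - p‖ * ‖w‖) ≤ ⟪z' - p, w⟫_ℝ := by
  have hMn : ‖-(Qx + Q₁ + Q₂)‖ = Real.sqrt 6 * a' := by rw [norm_neg, hM]
  have h23 : ((2 : ℝ) / 3) • (-(Qx + Q₁ + Q₂)) = Qz - Qx := by rw [hQz, smul_neg, neg_smul]
  have hD : ‖(z' - p) - ((2 : ℝ) / 3) • (-(Qx + Q₁ + Q₂))‖ ≤ 1 / 8 * a' := by
    have e : (z' - p) - ((2 : ℝ) / 3) • (-(Qx + Q₁ + Q₂)) = (z' - (q + Qz)) - (p - (q + Qx)) := by rw [h23]; abel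
    rw [e]
    calc ‖(z' - (q + Qz)) - (p - (q + Qx))‖ ≤ ‖z' - (q + Qz)‖ + ‖p - (q + Qx)‖ := norm_sub_le _ _
      _ ≤ 1 / 16 * a' + 1 / 16 * a' := add_le_add (by rw [← dist_eq_norm]; exact hz) (by rw [← dist_eq_norm]; exact hx)
      _ = 1 / 8 * a' := by ring
  exact apex_chain ha ha' hN hw (apex_near_x hq hh₁ hh₂) hMn (apex_near_c hx hh₁' hh₂') hD

/-- ★ **APEX LENGTHS** (c-pattern only): `(3/2)a′ ≤ ‖z′ − p‖ ≤ (44/25)a′` (`‖Q_z − Q_x‖ = (2/3)√6·a′ ∈ [1.6326, 1.6334]·a′`, tolerance `a′/8`).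
[this file, g80] -/
theorem apex_norm_bounds {p q z' Qx Q₁ Q₂ Qz : V} {a' : ℝ} (ha' : 0 ≤ a')
    (hx : dist p (q + Qx) ≤ 1 / 16 * a') (hz : dist z' (q + Qz) ≤ 1 / 16 * a') (hM : ‖Qx + Q₁ + Q₂‖ = Real.sqrt 6 * a')
    (hQz : Qz - Qx = -((2 : ℝ) / 3) • (Qx + Q₁ + Q₂)) :
    3 / 2 * a' ≤ ‖z' - p‖ ∧ ‖z' - p‖ ≤ 44 / 25 * a' := by
  have h6 := sqrt_six_ge
  have h6' := sqrt_six_le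
  have hQn : ‖Qz - Qx‖ = 2 / 3 * (Real.sqrt 6 * a') := by
    rw [hQz, norm_smul, Real.norm_of_nonpos (by norm_num : -((2 : ℝ) / 3) ≤ 0), hM]; ring
  have e : z' - p = ((z' - q - Qz) - (p - q - Qx)) + (Qz - Qx) := by abel
  have hE : ‖(z' - q - Qz) - (p - q - Qx)‖ ≤ 1 / 8 * a' :=
    calc ‖(z' - q - Qz) - (p - q - Qx)‖ ≤ ‖z' - q - Qz‖ + ‖p - q - Qx‖ := norm_sub_le _ _
      _ ≤ 1 / 16 * a' + 1 / 16 * a' :=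
          add_le_add (by rw [sub_sub, ← dist_eq_norm]; exact hz) (by rw [sub_sub, ← dist_eq_norm]; exact hx)
      _ = 1 / 8 * a' := by ring
  constructor
  · rw [e]
    have := norm_sub_norm_le (Qz - Qx) (-((z' - q - Qz) - (p - q - Qx)))
    rw [sub_neg_eq_add, add_comm (Qz - Qx), norm_neg] at this
    linarith [mul_le_mul_of_nonneg_right h6 ha']
  · rw [e]
    have := norm_add_le ((z' - q - Qz) - (p - q - Qx)) (Qz - Qx)
    linarith [mul_le_mul_of_nonneg_right h6' ha']

end Metric

/-! ### §3  Record numerology -/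

/-- the gains and reaches against ZZE's record cone step: double reach `17/8 ≤ 43/20` (`a′ ≤ 1`), apex reach `44/25 ≤ 43/20`; with the cone
inequality ZZE's `dist_add_half_le_of_cone` gives radial gains `½·(7/4)a′ = (7/8)a′` (doubles) and `½·(3/2)a′ = (3/4)a′` (apexes), both `≥ (3/4)·(9/10)`
at `a′ ≥ aLo = 9/10`; the certified cosines `0.6083` (double) and `0.5214` (apex) exceed `½`. [this file, g80] -/
theorem competitorCone_record_numerology :
    (17 : ℝ) / 8 ≤ 43 / 20 ∧ (44 : ℝ) / 25 ≤ 43 / 20 ∧ (1 : ℝ) / 2 * (7 / 4) = 7 / 8 ∧ (1 : ℝ) / 2 * (3 / 2) = 3 / 4 ∧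
      (27 : ℝ) / 40 ≤ 3 / 4 * (9 / 10) ∧
      (1 : ℝ) / 2 < 9977 / 10000 * (998 / 1000 * (7071 / 10000) - 633 / 10000 * (7072 / 10000)) - 68 / 1000 * (7505 / 10000) ∧
      (1 : ℝ) / 2 < 9970 / 10000 * (9964 / 10000 * (9917 / 10000 * (7453 / 10000) - 129 / 1000 * (6668 / 10000)) - 85 / 1000 * (7573 / 10000))
        - 78 / 1000 * (8101 / 10000) := by
  refine ⟨by norm_num, by norm_num, by norm_num, by norm_num, by norm_num, by norm_num, by norm_num⟩

end Summit.AtomisticToContinuum.Crystallization.Theorems.ChartedZeroExcessLayeredLatticeLiouville
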